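import Summits.QuantumFields.YangMills.Theorems.BalabanUVNodesK1EndExactNoJumpLadder

/-!
# ROW (iv) IN THRESHOLD CURRENCY: the explicit thresholds `γ∕√(1+Mγ²)` at every level, the two-time √-no-shrink law, and no-shrink AT THE SAME LEVEL
# (port with attribution of ym-nodeO P3 n°101 `TopRunsInRowsCurrency-P3g56.lean` §2 √-algebra + §3∕§4∕§6 corollaries, def-free)

Cell `pub-ymgap`, seat `pub-ymgap-dag-n13-w4` (g8), N13 [B16] width seat 4∕4; `--kind proof --supports stmt-QuantumFields-27364 --as helper` (K1⁹
`…Theses.BalabanUVNodes.StabilityBRunRowsAtRecordR13SepCoPHV`, crux r3 DECIDING, route rev 29, skeleton v10).  FILE 9 of this lineage's END-EXACTNESS census (FILE 7 p645556: rows vs dial =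
one quantifier swap; FILE 8 p647074: the dial's pointwise letter «no jump over the foot»).  PORT WITH ATTRIBUTION of the YM-NODE-O IDEATION cell's seat P3 («weaken the target») evidence n°101
`run/shared/lean/pub/ym-nodeO-ideate/memos/lines/TopRunsInRowsCurrency-P3g56.lean` (sha256 5a37335addab6d51…, 556 l., g56; evidence row 52 on stmt-QuantumFields-27364): its §2 √-threshold
algebra, §3's √-corollaries, §4's new same-level edge and §6's by-name corollaries at the record — the shapes `RunwisePSFloor` ∕ `TopRunPSFloor` ∕ `TopRunsAt` ∕ `SqrtNoShrink` are written
INLINE (theorems only, 0 `def`); P3's names kept decl by decl.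

THE POINT.  FILE 7 showed: for a FIXED `M`, K1⁹'s row (iv) at level `γ₀` ⟺ the top-anchored floor `M` at every level `γ ≤ γ₀`.  Here the floor is converted EXACTLY into thresholds: a
top-anchored floor `M` at level `γ` gives the threshold `g⋆(γ) = γ∕√(1+Mγ²)` (and conversely up to the same `M`), so
  ROW (iv) at `γ₀` with `M ≥ 0`  ⟺  (T) at EVERY level `γ ≤ γ₀` with the EXPLICIT thresholds `γ∕√(1+Mγ²)`  (★ `runwisePSFloor_iff_topRuns_sqrt`)
                                  ⟺  the TWO-TIME √-NO-SHRINK LAW `g_{n′} ≥ g_m∕√(1+M g_m²)` between any two times of an in-]0,γ₀] run (★ `runwisePSFloor_iff_sqrtNoShrink`),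
and in particular ROW (iv) ⟹ NO-(1+β₀)⁻¹-SHRINK AT THE SAME LEVEL `γ₀` with `1+β₀ = √(1+Mγ₀²)` (`noShrink_sqrt_of_runwisePSFloor`) — whereas the tree's edge (file 10 p617600
`runRowsNoShrink_of_runRowsPS`, via dag-n24-w1's `exists_noShrink_of_psFloor`) SHRINKS the level.  By name at the record (CONDITIONAL on K1⁹'s OPEN rows conjunct `K1R8RowsDefs.RunRowsCont13 F θ`):
`topRuns_sqrt_of_runRowsCont13` (the √-thresholds of `β_θ` at every level `≤ γ₀`) and ★ `runRowsNoShrink_sameLevel_of_runRowsCont13` (the no-shrink rows' ∃-text at the SAME level `γ′ = γ₀`).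

HONEST FRAMING.  [folklore] real analysis over the tree's carriers (`FlowStep.RGEqH`, `Step.InInterval`); implications between HYPOTHESIS SHAPES on an abstract `HBeta`; nothing of Bałaban
asserted; NOTHING about `Node00.betaOfRecord₁₃` inhabited (§3 is conditional on K1⁹'s open conjunct); no item filed ∕ re-keyed (R-30 reserve dial; HARD FREEZE №216); K1⁹ NOT closed (0∕6 stubs);
N13 NOT discharged; counts UNMOVED (typed 28∕28 · discharged 5∕27 · A 5∕28).  One finite 𝕋⁴ programme at fixed ε; R4 = the CONDITIONAL finite-𝕋⁴ rung `BalabanLadder.UV` only — the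
Yang–Mills mass gap (Clay) is NOT proved by any of this; nothing continuum ∕ ℝ⁴ ∕ OS.  No `sorry`, no `axiom`, no `def`, no `instance`, no `notation`.
Sources (locators only): [Balaban1987RG1] Commun. Math. Phys. 109 (1987) (0.20) p. 256, Thm 2 p. 259 (first sentence), Thm 3 p. 264, (5.10) p. 293; [Balaban1988Convergent] Commun. Math. Phys.
119 (1988) (2.6) p. 255; [Balaban1989LargeFieldII] Thm 1 + (0.1) pp. 355–356 (where K1's rows are consumed).
-/

noncomputable section

open scoped BigOperators

namespace Summit.QuantumFields.YangMills.Theorems.BalabanUVNodesK1EndExactSqrtThresholds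

open Literature.MathematicalPhysics.QuantumFieldTheory.Balaban1983to89
open Literature.MathematicalPhysics.QuantumFieldTheory.Balaban1983to89.FlowStep (HBeta prefixOf prefixOf_apply Box mem_box RGEqH)
open Literature.MathematicalPhysics.QuantumFieldTheory.Balaban1983to89.T4Continuum (T4Family)
open Summit.QuantumFields.YangMills.Theorems.BalabanUVNodesK2NamedJetsRunRemAt (RunConstRemainder SurvCont)
open Summit.QuantumFields.YangMills.Theorems.BalabanUVNodesK1R8RowsDefs (RunRowsCont13)
open Summit.QuantumFields.YangMills.Theorems.BalabanUVNodesK1WindowKOfRunRowsSurvivors (runwisePS_nonneg)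
open Summit.QuantumFields.YangMills.Theorems.BalabanUVNodesK1EndExactTopRunsFree (tail_sum_eq topRunPSFloor_of_topRunsAt topRunPSFloor_of_runwisePSFloor
  runwisePSFloor_of_topRunPSFloor_allLevels)
open Summit.QuantumFields.YangMills.Theorems.BalabanUVNodesK1EndExactNoJumpLadder (noShrink_of_linearTopRuns)

variable {β : HBeta}

/-! ## §1 The √-threshold algebra at one level — P3 n°101 §2 -/

section SqrtAlgebra

/-- the TOP form forces `0 ≤ M` (the one-point run at `γ`). P3 n°101 `topRunPSFloor_nonneg`. [folklore] -/
theorem topRunPSFloor_nonneg {M γ : ℝ} (hγ : 0 < γ)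
    (h : ∀ (n : ℕ) (gs : ℕ → ℝ), RGEqH n β gs → Step.InInterval γ n gs →
      ∀ k, k ≤ n → gs k = γ → -M ≤ ∑ j ∈ Finset.Ico k n, β j (prefixOf gs j)) : 0 ≤ M := by
  have := h 0 (fun _ => γ) (fun k hk => absurd hk (Nat.not_lt_zero _)) (fun k _ => ⟨hγ, le_rfl⟩) 0 le_rfl rfl
  simpa using this

/-- the √-threshold is positive. P3 n°101 `threshold_pos`. [folklore] -/
theorem threshold_pos {M γ : ℝ} (hγ : 0 < γ) (hM : 0 ≤ M) : 0 < γ / Real.sqrt (1 + M * γ ^ 2) := by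
  have hA : 0 < 1 + M * γ ^ 2 := by positivity
  exact div_pos hγ (Real.sqrt_pos.mpr hA)

/-- the floor-equivalent of the threshold `γ∕√(1+Mγ²)` is `M` exactly. P3 n°101 `inv_sq_threshold`. [folklore] -/
theorem inv_sq_threshold {M γ : ℝ} (hγ : 0 < γ) (hM : 0 ≤ M) :
    1 / (γ / Real.sqrt (1 + M * γ ^ 2)) ^ 2 - 1 / γ ^ 2 = M := by
  have hA : 0 < 1 + M * γ ^ 2 := by positivity
  rw [div_pow, Real.sq_sqrt hA.le, one_div_div]
  field_simp
  ring

/-- THE ALGEBRA OF THE √-PROFILE: `1∕y² ≤ 1∕x² + M` ⟹ `x∕√(1+Mx²) ≤ y` … P3 n°101 `sqrtThreshold_le_of_inv_sq_le`. [folklore] -/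
theorem sqrtThreshold_le_of_inv_sq_le {M x y : ℝ} (hx : 0 < x) (hy : 0 < y) (hM : 0 ≤ M)
    (h : 1 / y ^ 2 ≤ 1 / x ^ 2 + M) : x / Real.sqrt (1 + M * x ^ 2) ≤ y := by
  have hA : 0 < 1 + M * x ^ 2 := by positivity
  have hy2 : 0 < y ^ 2 := by positivity
  have hx2 : 0 < x ^ 2 := by positivity
  have h4 : 1 ≤ (1 / x ^ 2 + M) * y ^ 2 := by
    have := mul_le_mul_of_nonneg_right h hy2.le
    rwa [one_div_mul_cancel hy2.ne'] at this
  have h5 : (1 / x ^ 2 + M) * y ^ 2 * x ^ 2 = (1 + M * x ^ 2) * y ^ 2 := by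
    field_simp
  have h2 : x ^ 2 ≤ (1 + M * x ^ 2) * y ^ 2 := by
    nlinarith [mul_le_mul_of_nonneg_right h4 hx2.le]
  have h6 : x ^ 2 / (1 + M * x ^ 2) ≤ y ^ 2 := by rwa [div_le_iff₀' hA]
  calc x / Real.sqrt (1 + M * x ^ 2) = Real.sqrt (x ^ 2) / Real.sqrt (1 + M * x ^ 2) := by rw [Real.sqrt_sq hx.le]
    _ = Real.sqrt (x ^ 2 / (1 + M * x ^ 2)) := (Real.sqrt_div (sq_nonneg x) _).symm
    _ ≤ Real.sqrt (y ^ 2) := Real.sqrt_le_sqrt h6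
    _ = y := Real.sqrt_sq hy.le

/-- … and conversely. P3 n°101 `inv_sq_le_of_sqrtThreshold_le`. [folklore] -/
theorem inv_sq_le_of_sqrtThreshold_le {M x y : ℝ} (hx : 0 < x) (hM : 0 ≤ M)
    (h : x / Real.sqrt (1 + M * x ^ 2) ≤ y) : 1 / y ^ 2 ≤ 1 / x ^ 2 + M := by
  have hpos := threshold_pos hx hM
  have h1 : 1 / y ^ 2 ≤ 1 / (x / Real.sqrt (1 + M * x ^ 2)) ^ 2 :=
    one_div_le_one_div_of_le (by positivity) (pow_le_pow_left₀ hpos.le h 2)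
  have h2 := inv_sq_threshold hx hM
  linarith

/-- **THE TOP-ANCHORED FLOOR `M` AT LEVEL `γ` GIVES THE EXPLICIT THRESHOLD `γ∕√(1+Mγ²)`** (⟸ of FILE 2's `topRunThreshold_iff_topRunPSFloor`, threshold displayed).
P3 n°101 `topRunsAt_of_topRunPSFloor`. [cite: Balaban1987RG1, (0.20) p.256, Thm 2 p.259 (first sentence); Balaban1988Convergent, (2.6) p.255 (elementary)] -/
theorem topRunsAt_of_topRunPSFloor {M γ : ℝ} (hγ : 0 < γ)
    (h : ∀ (n : ℕ) (gs : ℕ → ℝ), RGEqH n β gs → Step.InInterval γ n gs →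
      ∀ k, k ≤ n → gs k = γ → -M ≤ ∑ j ∈ Finset.Ico k n, β j (prefixOf gs j)) :
    ∀ (n : ℕ) (gs : ℕ → ℝ), RGEqH n β gs → Step.InInterval γ n gs → ∀ k, k ≤ n → gs k = γ → γ / Real.sqrt (1 + M * γ ^ 2) ≤ gs n := by
  have hM := topRunPSFloor_nonneg hγ h
  intro n gs hrg hI k hk hgk
  have hs := h n gs hrg hI k hk hgk
  rw [tail_sum_eq hrg hk, hgk] at hs
  exact sqrtThreshold_le_of_inv_sq_le hγ (hI n le_rfl).1 hM (by linarith)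

end SqrtAlgebra

/-! ## §2 Row (iv) in threshold currency: √-thresholds at every level; the two-time √-no-shrink law; no-shrink AT THE SAME LEVEL — P3 n°101 §3∕§4 -/

section RowIV

/-- ★ **ROW (iv) ⟹ (T) AT EVERY LEVEL `≤ γ₀` WITH THRESHOLD `γ∕√(1+Mγ²)`** (relative loss `≤ Mγ²∕2 → 0`): FILE 7's trivial direction + §1. P3 n°101 `topRunsAt_of_runwisePSFloor`.
[cite: Balaban1987RG1, (0.20) p.256, Thm 2 p.259 (first sentence), (5.10) p.293; Balaban1988Convergent, (2.6) p.255 (elementary)] -/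
theorem topRunsAt_sqrt_of_runwisePSFloor {M γ₀ : ℝ}
    (h : ∀ (n : ℕ) (gs : ℕ → ℝ), RGEqH n β gs → Step.InInterval γ₀ n gs → ∀ k, k ≤ n → -M ≤ ∑ j ∈ Finset.Ico k n, β j (prefixOf gs j))
    {γ : ℝ} (hγ : 0 < γ) (hle : γ ≤ γ₀) :
    ∀ (n : ℕ) (gs : ℕ → ℝ), RGEqH n β gs → Step.InInterval γ n gs → ∀ k, k ≤ n → gs k = γ → γ / Real.sqrt (1 + M * γ ^ 2) ≤ gs n :=
  topRunsAt_of_topRunPSFloor hγ (topRunPSFloor_of_runwisePSFloor h hle)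

/-- ★★ **EXACT THRESHOLD FORM OF ROW (iv)**: for `0 ≤ M`, row (iv) at `γ₀` with `M` ⟺ (T) at every level `γ ≤ γ₀` with threshold `γ∕√(1+Mγ²)` (⟸: the floor-equivalents of these
thresholds are `M` uniformly, §1's `inv_sq_threshold`, so FILE 7's `runwisePSFloor_of_topRuns_uniform` applies). P3 n°101 `runwisePSFloor_iff_topRuns_sqrt`.
[cite: Balaban1987RG1, (0.20) p.256, (5.10) p.293; Balaban1988Convergent, (2.6) p.255 (elementary)] -/
theorem runwisePSFloor_iff_topRuns_sqrt {M γ₀ : ℝ} (hM : 0 ≤ M) :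
    (∀ (n : ℕ) (gs : ℕ → ℝ), RGEqH n β gs → Step.InInterval γ₀ n gs → ∀ k, k ≤ n → -M ≤ ∑ j ∈ Finset.Ico k n, β j (prefixOf gs j)) ↔
      ∀ γ : ℝ, 0 < γ → γ ≤ γ₀ →
        ∀ (n : ℕ) (gs : ℕ → ℝ), RGEqH n β gs → Step.InInterval γ n gs → ∀ k, k ≤ n → gs k = γ → γ / Real.sqrt (1 + M * γ ^ 2) ≤ gs n := by
  refine ⟨fun h γ hγ hle => topRunsAt_sqrt_of_runwisePSFloor h hγ hle, fun h => ?_⟩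
  refine runwisePSFloor_of_topRunPSFloor_allLevels fun γ hγ hle n gs hrg hI k hk hgk => ?_
  have hT := topRunPSFloor_of_topRunsAt (β := β) (threshold_pos hγ hM) (h γ hγ hle) n gs hrg hI k hk hgk
  rwa [inv_sq_threshold hγ hM] at hT

/-- **ROW (iv) ⟹ THE TWO-TIME √-NO-SHRINK LAW**: between ANY two times `m ≤ n′` of an in-`]0,γ₀]` run, `g_{n′} ≥ g_m∕√(1 + M g_m²)` (read the initial segment `[0, n′]` and its tail from `m`;
`0 < γ₀` makes `M ≥ 0` via this lineage's `runwisePS_nonneg`). P3 n°101 `sqrtNoShrink_of_runwisePSFloor`. [cite: Balaban1988Convergent, (2.6) p.255; Balaban1987RG1, (0.20) p.256 (elementary)] -/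
theorem sqrtNoShrink_of_runwisePSFloor {M γ₀ : ℝ} (hγ₀ : 0 < γ₀)
    (h : ∀ (n : ℕ) (gs : ℕ → ℝ), RGEqH n β gs → Step.InInterval γ₀ n gs → ∀ k, k ≤ n → -M ≤ ∑ j ∈ Finset.Ico k n, β j (prefixOf gs j)) :
    ∀ (n : ℕ) (gs : ℕ → ℝ), RGEqH n β gs → Step.InInterval γ₀ n gs →
      ∀ m n', m ≤ n' → n' ≤ n → gs m / Real.sqrt (1 + M * (gs m) ^ 2) ≤ gs n' := by
  have hM := runwisePS_nonneg hγ₀ h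
  intro n gs hrg hI m n' hm hn'
  have hrg' : RGEqH n' β gs := fun k hk => hrg k (lt_of_lt_of_le hk hn')
  have hI' : Step.InInterval γ₀ n' gs := fun k hk => hI k (hk.trans hn')
  have hs := h n' gs hrg' hI' m hm
  rw [tail_sum_eq hrg' hm] at hs
  exact sqrtThreshold_le_of_inv_sq_le (hI m (hm.trans hn')).1 (hI n' hn').1 hM (by linarith)

/-- **… AND CONVERSELY** (`0 ≤ M`): the two-time √-no-shrink law gives row (iv) with the same `M` (take `n′ := n`). P3 n°101 `runwisePSFloor_of_sqrtNoShrink`. [folklore] -/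
theorem runwisePSFloor_of_sqrtNoShrink {M γ₀ : ℝ} (hM : 0 ≤ M)
    (h : ∀ (n : ℕ) (gs : ℕ → ℝ), RGEqH n β gs → Step.InInterval γ₀ n gs →
      ∀ m n', m ≤ n' → n' ≤ n → gs m / Real.sqrt (1 + M * (gs m) ^ 2) ≤ gs n') :
    ∀ (n : ℕ) (gs : ℕ → ℝ), RGEqH n β gs → Step.InInterval γ₀ n gs → ∀ k, k ≤ n → -M ≤ ∑ j ∈ Finset.Ico k n, β j (prefixOf gs j) := by
  intro n gs hrg hI k hk
  have h1 := inv_sq_le_of_sqrtThreshold_le (hI k hk).1 hM (h n gs hrg hI k n hk le_rfl)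
  rw [tail_sum_eq hrg hk]
  linarith

/-- ★★ **ROW (iv) IS THE TWO-TIME √-NO-SHRINK LAW** (`0 < γ₀`, `0 ≤ M`) — the multiplicative reading of K1⁹'s partial-sum floor (compare [III] (2.6)'s last member `g_{n′} ≥ g_m∕(1+β₀)`, a
level-independent factor). P3 n°101 `runwisePSFloor_iff_sqrtNoShrink`. [cite: Balaban1988Convergent, (2.6) p.255; Balaban1987RG1, (0.20) p.256, (5.10) p.293 (elementary)] -/
theorem runwisePSFloor_iff_sqrtNoShrink {M γ₀ : ℝ} (hγ₀ : 0 < γ₀) (hM : 0 ≤ M) :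
    (∀ (n : ℕ) (gs : ℕ → ℝ), RGEqH n β gs → Step.InInterval γ₀ n gs → ∀ k, k ≤ n → -M ≤ ∑ j ∈ Finset.Ico k n, β j (prefixOf gs j)) ↔
      ∀ (n : ℕ) (gs : ℕ → ℝ), RGEqH n β gs → Step.InInterval γ₀ n gs →
        ∀ m n', m ≤ n' → n' ≤ n → gs m / Real.sqrt (1 + M * (gs m) ^ 2) ≤ gs n' :=
  ⟨sqrtNoShrink_of_runwisePSFloor hγ₀, runwisePSFloor_of_sqrtNoShrink hM⟩

/-- ★ **ROW (iv) ⟹ NO-SHRINK AT THE SAME LEVEL `γ₀` with the factor `√(1+Mγ₀²)`** (the tree edge `…K1EndOfRunRowsNoShrinkSurvCont.runRowsNoShrink_of_runRowsPS` ∕ dag-n24-w1's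
`exists_noShrink_of_psFloor` instead SHRINK the level to some `γ′ ≤ γ₀`): the rows' thresholds `γ∕√(1+Mγ²)` dominate the linear ones `γ∕√(1+Mγ₀²)` on `]0, γ₀]`, then FILE 8's converse edge
`noShrink_of_linearTopRuns`. P3 n°101 `runwiseMulFloor_sqrt_of_runwisePSFloor`. [cite: Balaban1988Convergent, (2.6) p.255 (last member); Balaban1987RG1, (0.20) p.256, (5.10) p.293 (elementary)] -/
theorem noShrink_sqrt_of_runwisePSFloor {M γ₀ : ℝ} (hγ₀ : 0 < γ₀)
    (h : ∀ (n : ℕ) (gs : ℕ → ℝ), RGEqH n β gs → Step.InInterval γ₀ n gs → ∀ k, k ≤ n → -M ≤ ∑ j ∈ Finset.Ico k n, β j (prefixOf gs j)) :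
    ∀ (n : ℕ) (gs : ℕ → ℝ), RGEqH n β gs → Step.InInterval γ₀ n gs →
      ∀ m n', m < n' → n' ≤ n → gs m ≤ (1 + (Real.sqrt (1 + M * γ₀ ^ 2) - 1)) * gs n' := by
  have hM := runwisePS_nonneg hγ₀ h
  have hs1 : 1 ≤ Real.sqrt (1 + M * γ₀ ^ 2) :=
    calc (1 : ℝ) = Real.sqrt 1 := Real.sqrt_one.symm
      _ ≤ Real.sqrt (1 + M * γ₀ ^ 2) := Real.sqrt_le_sqrt (le_add_of_nonneg_right (mul_nonneg hM (sq_nonneg γ₀)))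
  refine noShrink_of_linearTopRuns (by linarith) fun γ hγ hle n gs hrg hI k hk hgk => ?_
  have hT := topRunsAt_sqrt_of_runwisePSFloor h hγ hle n gs hrg hI k hk hgk
  refine le_trans ?_ hT
  rw [show 1 + (Real.sqrt (1 + M * γ₀ ^ 2) - 1) = Real.sqrt (1 + M * γ₀ ^ 2) by ring]
  have hB : 0 < 1 + M * γ ^ 2 := by positivity
  exact div_le_div_of_nonneg_left hγ.le (Real.sqrt_pos.mpr hB)
    (Real.sqrt_le_sqrt (by nlinarith [mul_le_mul_of_nonneg_left (pow_le_pow_left₀ hγ.le hle 2) hM]))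

end RowIV

/-! ## §3 By name at the record's `β_θ` (CONDITIONAL on K1⁹'s OPEN rows conjunct `K1R8RowsDefs.RunRowsCont13 F θ`) — P3 n°101 §6 -/

section AtRecord

/-- **K1⁹'s ROWS ⟹ THE √-THRESHOLDS OF `β_θ` AT EVERY LEVEL `≤ γ₀`**: `K1R8RowsDefs.RunRowsCont13 F θ` (stmt-QuantumFields-27364's last conjunct, `Iff.rfl`) gives `γ₀ > 0` and `M ≥ 0` (the rows' own
floor) with the top-anchored floor at every level AND the explicit thresholds `γ∕√(1+Mγ²)` for `β_θ := Node00.betaOfRecord₁₃ F 2 θ.toStage13Params` — row (iv) read ALONE, in the dial's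
currency, level-uniform.  CONDITIONAL on the OPEN conjunct; nothing about `betaOfRecord₁₃` inhabited. P3 n°101 `topRuns_sqrt_of_runRowsCont13`.
[cite: Balaban1987RG1, Thm 3 p.264, (5.10) p.293, (0.20) p.256, Thm 2 p.259 (first sentence) (bookkeeping)] -/
theorem topRuns_sqrt_of_runRowsCont13 {F : T4Family} {θ : Node00.Stage13HParams F 2} (h : RunRowsCont13 F θ) :
    ∃ γ₀ M : ℝ, 0 < γ₀ ∧ 0 ≤ M ∧
      (∀ (n : ℕ) (gs : ℕ → ℝ), RGEqH n (Node00.betaOfRecord₁₃ F 2 θ.toStage13Params) gs → Step.InInterval γ₀ n gs →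
        ∀ k, k ≤ n → -M ≤ ∑ j ∈ Finset.Ico k n, Node00.betaOfRecord₁₃ F 2 θ.toStage13Params j (prefixOf gs j)) ∧
      (∀ γ : ℝ, 0 < γ → γ ≤ γ₀ → ∀ (n : ℕ) (gs : ℕ → ℝ), RGEqH n (Node00.betaOfRecord₁₃ F 2 θ.toStage13Params) gs → Step.InInterval γ n gs →
        ∀ k, k ≤ n → gs k = γ → -M ≤ ∑ j ∈ Finset.Ico k n, Node00.betaOfRecord₁₃ F 2 θ.toStage13Params j (prefixOf gs j)) ∧
      (∀ γ : ℝ, 0 < γ → γ ≤ γ₀ → ∀ (n : ℕ) (gs : ℕ → ℝ), RGEqH n (Node00.betaOfRecord₁₃ F 2 θ.toStage13Params) gs → Step.InInterval γ n gs →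
        ∀ k, k ≤ n → gs k = γ → γ / Real.sqrt (1 + M * γ ^ 2) ≤ gs n) := by
  obtain ⟨_, _, γ₀, M, hγ₀, -, hps, -⟩ := h
  exact ⟨γ₀, M, hγ₀, runwisePS_nonneg hγ₀ hps, hps, fun _ _ hle => topRunPSFloor_of_runwisePSFloor hps hle,
    fun γ hγ hle => topRunsAt_sqrt_of_runwisePSFloor hps hγ hle⟩

/-- ★ **K1⁹'s ROWS (i)(iv)(C) ⟹ THE NO-SHRINK ROWS AT THE SAME LEVEL** — the consequent TEXT of the tree edge `…K1EndOfRunRowsNoShrinkSurvCont.runRowsNoShrink_of_runRowsPS` (p617600 :274,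
which shrinks the level to some `γ′ ≤ γ₀` with `β₀ = 1`), here with `γ′ = γ₀` and `1 + β₀ = √(1+Mγ₀²)` (§2's same-level edge); rows (i) and (C) pass unchanged.  CONDITIONAL on the OPEN
conjunct; nothing of Bałaban asserted. P3 n°101 `runRowsNoShrink_sameLevel_of_runRowsCont13`. [cite: Balaban1988Convergent, (2.6) p.255; Balaban1987RG1, (0.20) p.256, Thm 3 p.264, (5.10) p.293 (bookkeeping)] -/
theorem runRowsNoShrink_sameLevel_of_runRowsCont13 {F : T4Family} {θ : Node00.Stage13HParams F 2} (h : RunRowsCont13 F θ) :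
    ∃ (b : ℕ → ℝ) (r γ₀ γ' β₀ : ℝ), 0 < γ' ∧ γ' ≤ γ₀ ∧ 0 ≤ β₀ ∧ γ' = γ₀ ∧
      RunConstRemainder (Node00.betaOfRecord₁₃ F 2 θ.toStage13Params) b r γ₀ ∧
      (∀ (n : ℕ) (gs : ℕ → ℝ), RGEqH n (Node00.betaOfRecord₁₃ F 2 θ.toStage13Params) gs → Step.InInterval γ' n gs →
        ∀ m n', m < n' → n' ≤ n → gs m ≤ (1 + β₀) * gs n') ∧
      SurvCont (Node00.betaOfRecord₁₃ F 2 θ.toStage13Params) γ₀ := by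
  obtain ⟨b, r, γ₀, M, hγ₀, hrem, hps, hsc⟩ := h
  have hM : 0 ≤ M := runwisePS_nonneg hγ₀ hps
  have hs1 : 1 ≤ Real.sqrt (1 + M * γ₀ ^ 2) :=
    calc (1 : ℝ) = Real.sqrt 1 := Real.sqrt_one.symm
      _ ≤ Real.sqrt (1 + M * γ₀ ^ 2) := Real.sqrt_le_sqrt (le_add_of_nonneg_right (mul_nonneg hM (sq_nonneg γ₀)))
  exact ⟨b, r, γ₀, γ₀, Real.sqrt (1 + M * γ₀ ^ 2) - 1, hγ₀, le_rfl, by linarith, rfl, hrem, noShrink_sqrt_of_runwisePSFloor hγ₀ hps, hsc⟩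

end AtRecord

end Summit.QuantumFields.YangMills.Theorems.BalabanUVNodesK1EndExactSqrtThresholds

end
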